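import Literature.Probability.Percolation.LoopRepresentation
import Literature.Probability.Percolation.LoopRotationInvarianceAssembly
import Literature.Probability.RandomPlanarGeometry.LoopConfigurationsMetric
import HarnessLib

/-!
# DKKMO's Theorem 1.2 from their Theorem 1.7, in the printed `d_CN` conventions (Remark 1.8)

Proofs layer of `Literature.Probability.Percolation.LoopRepresentation`: the named fact
`dkkmo_theorem_1_2` (Duminil-Copin–Kozlowski–Krachun–Manolescu–Oulamara, arXiv:2012.11672v2
(2026), Theorem 1.2 at `q = 1`, `d_CN` part, **as printed**: typed unbased loops, the distance
`d` of eq. (1), the soft window `B(0, 1/ε)`, the coupling distance of eq. (2)) is reduced to the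
named fact `dkkmo_theorem_1_7` (their Theorem 1.7, same conventions) by the argument of their
Remark 1.8 / §4.1, formalised completely:

> "Theorem 1.7 readily implies Theorem 1.2. Indeed, for any `α ∈ (0, π)`, `e^{iα/2}ℝ` is an
> axis of symmetry for `L(α)`, and therefore for `φ_{L(α)}`. Then (4) implies that `φ_{L(π/2)}`
> is asymptotically invariant under the reflection with respect to `e^{iα/2}ℝ`. The composition
> of the reflections with respect to the horizontal axis and to `e^{iα/2}ℝ` produces the rotation
> by an angle `α`, hence the asymptotic invariance of `φ_{L(π/2)}` under this rotation."

Main result: `dkkmo_theorem_1_2_of_theorem_1_7 : dkkmo_theorem_1_7 → dkkmo_theorem_1_2`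
(proved; no other hypothesis; constant `4C`, same exponent `c`). The companion file
`LoopRotationInvarianceAssembly` runs the same argument in the tree's own conventions (laws on
`LoopSpace ℂ`, Lévy–Prokhorov); here the printed coupling distance forces genuine coupling
surgery (`LoopConfig.cnLawEDist_triangle`, gluing by disintegration) and the loops carry DKKMO's
types, whose invariance under the lattice reflections is proved from the shoelace formula.

## Contents

* `shoelace_reverse`, `shoelace_map_of_det`, `loopType_map_reverse` (+ `reflSite`, `swapSite`
  instances): the orientation type is invariant under reflect-and-reverse.
* `gen_bondLoopConfig`, `gen_isoRectLoopConfig`, `measurableSet_isClose_bondLoopConfig`: the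
  lattice loop representations are countably generated, so the events `{d_CN ≤ ε}` are
  measurable.
* `bondLoopConfig_add` (rotating the lattice rotates the representation), `bondLoopConfig_periodic`,
  `isClose_bondLoopConfig_add`, `cnLawEDist_bondLoopConfig_add` (rotation invariance).
* `mem_isoRectLoopConfig_image_iff`, `isClose_isoRectLoopConfig_image_iff`: a lattice reflection
  realised by `S` on `δL(α)` maps the typed loop representation to its `S`-image with members
  reversed (`isoRectLoopCurve_map_reverse`, `IsLatticeReflection.isInterfaceLoop`).
* `standardBorelSpace_bondConfig`; `cnLawEDist_rotate_le` (Remark 1.8 for the coupling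
  distance: `d_CN(X, R_θ X) ≤ 2 d_CN(X_θ, X)`); `cnLawEDist_bondLoopConfig_subadditive`;
  `dkkmo_theorem_1_2_of_theorem_1_7`.

## References

* H. Duminil-Copin, K. K. Kozlowski, D. Krachun, I. Manolescu, M. Oulamara, arXiv:2012.11672v2
  (2026): §1.2 (eq. (1)–(2)), Theorem 1.2, §1.4, Theorem 1.7, Remark 1.8, §4.1; v1 (2020) §7.1.
* F. Camia, C. M. Newman, Comm. Math. Phys. 268 (2006), §2, §4 (oriented cluster boundaries).
* G. Grimmett, *Percolation*, 2nd ed. (1999), §11.2 (medial lattice of `ℤ²`).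
-/

noncomputable section

open Set MeasureTheory ProbabilityTheory
open scoped unitInterval ENNReal Real

namespace Literature.Probability.Percolation

open LatticeModels

/-! ### The orientation type is invariant under reflect-and-reverse -/

/-- The shoelace sum as a `zipWith`-sum of the antisymmetric form `p × q = p₁ q₂ − q₁ p₂`
over consecutive vertices. [folklore] -/
theorem shoelace_eq_zipWith_sum (l : List ℂ) :
    shoelace l = (List.zipWith (fun p q : ℂ ↦ p.re * q.im - q.re * p.im) l (l.rotate 1)).sum := by
  rw [shoelace, ← List.map_uncurry_zip_eq_zipWith]
  rfl

/-- **Reversing the vertex list negates the signed area.** [folklore] -/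
theorem shoelace_reverse (l : List ℂ) : shoelace l.reverse = -shoelace l := by
  have hanti : ∀ l₁ l₂ : List ℂ,
      (List.zipWith (fun p q : ℂ ↦ p.re * q.im - q.re * p.im) l₁ l₂).sum =
        -(List.zipWith (fun p q : ℂ ↦ p.re * q.im - q.re * p.im) l₂ l₁).sum := by
    intro l₁ l₂
    rw [List.zipWith_comm, List.sum_neg, List.map_zipWith]
    congr 2
    funext b a
    ring
  have hcyc : ∀ (L : List ℂ) (k : ℕ),
      (List.zipWith (fun p q : ℂ ↦ p.re * q.im - q.re * p.im) (L.rotate k) (L.rotate (k + 1))).sum =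
        shoelace L := by
    intro L k
    rw [← List.rotate_rotate, ← shoelace_eq_zipWith_sum, shoelace_rotate]
  rcases l with _ | ⟨a, t⟩
  · simp [shoelace]
  rcases t with _ | ⟨b, t⟩
  · simp [shoelace]
  set l := a :: b :: t with hl
  have hn : 2 ≤ l.length := by simp [hl]
  have hrot : l.reverse.rotate 1 = (l.rotate (l.length - 1)).reverse := by
    rw [List.rotate_reverse, Nat.mod_eq_of_lt (by omega)]
  have key : (List.zipWith (fun p q : ℂ ↦ p.re * q.im - q.re * p.im) (l.rotate (l.length - 1)) l).sum =
      shoelace l := by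
    have := hcyc l (l.length - 1)
    rwa [Nat.sub_add_cancel (by omega : 1 ≤ l.length), List.rotate_length] at this
  rw [shoelace_eq_zipWith_sum l.reverse, hrot, ← List.reverse_zipWith (by simp), List.sum_reverse,
    hanti, key]

/-- A map of the plane multiplying the form `p₁ q₂ − q₁ p₂` by the constant `D` (a real-linear
map of determinant `D`) multiplies the shoelace sum by `D`. [folklore] -/
theorem shoelace_map_of_det (f : ℂ → ℂ) (D : ℝ)
    (hf : ∀ p q : ℂ, (f p).re * (f q).im - (f q).re * (f p).im = D * (p.re * q.im - q.re * p.im))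
    (l : List ℂ) : shoelace (l.map f) = D * shoelace l := by
  unfold shoelace
  rw [← List.map_rotate, List.zip_map, List.map_map, ← List.sum_map_mul_left]
  congr 1
  refine List.map_congr_left fun p _ ↦ ?_
  simp only [Function.comp_apply, Prod.map_fst, Prod.map_snd, hf]

/-- **The signed area of a reflected loop read backwards equals the signed area of the loop**:
for a lattice map `τ` realised on the `ℤ²`-midpoints by an orientation-reversing map `f` of the
plane (the form `p₁ q₂ − q₁ p₂` changes sign), reflection and reversal each change the sign of
the shoelace sum. [folklore] -/
theorem loopSignedArea_map_reverse {τ : Site 2 → Site 2} {f : ℂ → ℂ}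
    (hτ : ∀ e, medialPoint 1 (e.map τ) = f (medialPoint 1 e))
    (hf : ∀ p q : ℂ, (f p).re * (f q).im - (f q).re * (f p).im = -(p.re * q.im - q.re * p.im))
    (γ : List MedialVertex) :
    loopSignedArea ((γ.map (Sym2.map τ)).reverse) = loopSignedArea γ := by
  rw [loopSignedArea, loopSignedArea, List.map_reverse, shoelace_reverse, List.map_map]
  have hcomp : medialPoint 1 ∘ Sym2.map τ = f ∘ medialPoint 1 := funext hτ
  rw [hcomp, ← List.map_map, shoelace_map_of_det f (-1) (fun p q ↦ by rw [hf]; ring)]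
  ring

/-- The orientation type of an interface loop is invariant under reflect-and-reverse by an
orientation-reversing lattice symmetry: exterior boundaries of primal clusters go to exterior
boundaries of primal clusters (DKKMO, arXiv:2012.11672v2, Remark 1.8: a symmetry of the lattice
is a symmetry of the model). [folklore] -/
theorem loopType_map_reverse {τ : Site 2 → Site 2} {f : ℂ → ℂ}
    (hτ : ∀ e, medialPoint 1 (e.map τ) = f (medialPoint 1 e))
    (hf : ∀ p q : ℂ, (f p).re * (f q).im - (f q).re * (f p).im = -(p.re * q.im - q.re * p.im))
    (γ : List MedialVertex) : loopType ((γ.map (Sym2.map τ)).reverse) = loopType γ := by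
  rw [loopType, loopSignedArea_map_reverse hτ hf, loopType]

/-- Types are invariant under `reflSite` (`(m, n) ↦ (m, -n)`, complex conjugation on midpoints)
followed by reversal. [folklore] -/
theorem loopType_map_reflSite_reverse (γ : List MedialVertex) :
    loopType ((γ.map (Sym2.map reflSite)).reverse) = loopType γ :=
  loopType_map_reverse (f := starRingEnd ℂ) (medialPoint_map_reflSite 1)
    (fun p q ↦ by simp only [Complex.conj_re, Complex.conj_im]; ring) γ

/-- Types are invariant under `swapSite` (`(m, n) ↦ (-n, -m)`, `z ↦ -i z̄` on midpoints)
followed by reversal. [folklore] -/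
theorem loopType_map_swapSite_reverse (γ : List MedialVertex) :
    loopType ((γ.map (Sym2.map swapSite)).reverse) = loopType γ :=
  loopType_map_reverse (f := fun z ↦ -Complex.I * (starRingEnd ℂ) z) (medialPoint_map_swapSite 1)
    (fun p q ↦ by
      simp only [Complex.mul_re, Complex.mul_im, Complex.neg_re, Complex.neg_im, Complex.I_re,
        Complex.I_im, Complex.conj_re, Complex.conj_im]
      ring) γ

/-! ### Countable generation and measurability of the events `d_CN ≤ ε` -/

/-- The loop representation on `δ e^{iα} ℤ²` is countably generated: by the loops of the nonempty
dart lists, switched on by the events "`γ` is an interface loop of `ω` of type `i`". [folklore] -/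
theorem gen_bondLoopConfig (δ α : ℝ) :
    ∀ (ω : BondConfig (Site 2)) (i : Fin 2) (u : RandomPlanarGeometry.UnbasedLoop ℂ),
      u ∈ (bondLoopConfig δ α ω).F i ↔ ∃ k : {γ : List MedialVertex // γ ≠ []},
        ω ∈ {ω | IsInterfaceLoop ω k.1 ∧ loopType k.1 = i} ∧
          RandomPlanarGeometry.UnbasedLoop.mk (RandomPlanarGeometry.BasedLoop.mk (loopCurve δ α k.1)
            (isLoop_loopCurve δ α k.2)) = u := by
  intro ω i u
  rw [mem_bondLoopConfig_iff]
  constructor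
  · rintro ⟨γ, h, ht, rfl⟩
    exact ⟨⟨γ, h.ne_nil⟩, ⟨h, ht⟩, rfl⟩
  · rintro ⟨⟨γ, hγ⟩, ⟨h, ht⟩, rfl⟩
    exact ⟨γ, h, ht, rfl⟩

/-- The loop representation on `δ L(α)` is countably generated. [folklore] -/
theorem gen_isoRectLoopConfig (δ α : ℝ) :
    ∀ (ω : BondConfig (Site 2)) (i : Fin 2) (u : RandomPlanarGeometry.UnbasedLoop ℂ),
      u ∈ (isoRectLoopConfig δ α ω).F i ↔ ∃ k : {γ : List MedialVertex // γ ≠ []},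
        ω ∈ {ω | IsInterfaceLoop ω k.1 ∧ loopType k.1 = i} ∧
          RandomPlanarGeometry.UnbasedLoop.mk (RandomPlanarGeometry.BasedLoop.mk (isoRectLoopCurve δ α k.1)
            (isLoop_isoRectLoopCurve δ α k.2)) = u := by
  intro ω i u
  rw [mem_isoRectLoopConfig_iff]
  constructor
  · rintro ⟨γ, h, ht, rfl⟩
    exact ⟨⟨γ, h.ne_nil⟩, ⟨h, ht⟩, rfl⟩
  · rintro ⟨⟨γ, hγ⟩, ⟨h, ht⟩, rfl⟩
    exact ⟨γ, h, ht, rfl⟩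

/-- The generating events "`γ` is an interface loop of `ω` of type `i`" are measurable. [folklore] -/
theorem measurableSet_setOf_isInterfaceLoop_and (γ : List MedialVertex) (i : Fin 2) :
    MeasurableSet {ω : BondConfig (Site 2) | IsInterfaceLoop ω γ ∧ loopType γ = i} :=
  measurableSet_setOf.2 ((measurable_isInterfaceLoop γ).and measurable_const)

/-- Measurability of `{d_CN ≤ ε}` for two square-lattice loop representations. [folklore] -/
theorem measurableSet_isClose_bondLoopConfig (δ α δ' β : ℝ) (ε : ℝ) :
    MeasurableSet {p : BondConfig (Site 2) × BondConfig (Site 2) |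
      RandomPlanarGeometry.LoopConfig.IsClose ε (bondLoopConfig δ α p.1) (bondLoopConfig δ' β p.2)} :=
  RandomPlanarGeometry.LoopConfig.measurableSet_isClose_of_gen
    (fun i (k : {γ : List MedialVertex // γ ≠ []}) ↦ measurableSet_setOf_isInterfaceLoop_and k.1 i)
    (gen_bondLoopConfig δ α)
    (fun i (k : {γ : List MedialVertex // γ ≠ []}) ↦ measurableSet_setOf_isInterfaceLoop_and k.1 i)
    (gen_bondLoopConfig δ' β) ε

/-! ### Rotating the square lattice rotates the loop representation -/

/-- Rotating the lattice by `α` pushes the loop representation forward along the rotation: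
`bondLoopConfig δ (α + β) ω = R_α (bondLoopConfig δ β ω)` (from `loopCurve_add`).
(DKKMO, arXiv:2012.11672v2, §1.3: "`φ_{e^{iα}δℤ²}` … the lattice `δℤ²` rotated by `α`".) [cite: arXiv201211672v2, §1.3] -/
theorem bondLoopConfig_add (δ α β : ℝ) (ω : BondConfig (Site 2)) :
    bondLoopConfig δ (α + β) ω = (bondLoopConfig δ β ω).map
      (RandomPlanarGeometry.toCM (rotation (Circle.exp α))) (rotation (Circle.exp α)).isometry := by
  ext i u
  simp only [mem_bondLoopConfig_iff, RandomPlanarGeometry.LoopConfig.mem_map_iff]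
  constructor
  · rintro ⟨γ, h, ht, rfl⟩
    refine ⟨_, ⟨γ, h, ht, rfl⟩, ?_⟩
    rw [RandomPlanarGeometry.UnbasedLoop.map_mk, RandomPlanarGeometry.BasedLoop.map_mk]
    congr 1
    exact (RandomPlanarGeometry.BasedLoop.mk_eq_mk.2 (loopCurve_add δ α β γ)).symm
  · rintro ⟨_, ⟨γ, h, ht, rfl⟩, rfl⟩
    refine ⟨γ, h, ht, ?_⟩
    rw [RandomPlanarGeometry.UnbasedLoop.map_mk, RandomPlanarGeometry.BasedLoop.map_mk]
    congr 1
    exact (RandomPlanarGeometry.BasedLoop.mk_eq_mk.2 (loopCurve_add δ α β γ)).symm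

/-- The loop representation is `2π`-periodic in the angle. [folklore] -/
theorem bondLoopConfig_periodic (δ α : ℝ) (n : ℤ) :
    bondLoopConfig δ (α + n * (2 * π)) = bondLoopConfig δ α := by
  funext ω
  ext i u
  simp only [mem_bondLoopConfig_iff, loopCurve_congr (Circle.exp_eq_exp.2 ⟨n, rfl⟩)]

/-- **Rotation invariance of the printed `d_CN ≤ ε` on `ℤ²`**: rotating both lattices by `θ`
does not change the relation (an isometry fixing the origin). [folklore] -/
theorem isClose_bondLoopConfig_add (δ δ' θ α β ε : ℝ) (ω ω' : BondConfig (Site 2)) :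
    RandomPlanarGeometry.LoopConfig.IsClose ε (bondLoopConfig δ (θ + α) ω) (bondLoopConfig δ' (θ + β) ω') ↔
      RandomPlanarGeometry.LoopConfig.IsClose ε (bondLoopConfig δ α ω) (bondLoopConfig δ' β ω') := by
  rw [bondLoopConfig_add, bondLoopConfig_add,
    RandomPlanarGeometry.LoopConfig.isClose_map_iff _ (map_zero (rotation (Circle.exp θ)))]

/-- Rotation invariance of the coupling distance between square-lattice loop representations. [folklore] -/
theorem cnLawEDist_bondLoopConfig_add (μ ν : Measure (BondConfig (Site 2))) (δ δ' θ α β : ℝ) :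
    RandomPlanarGeometry.LoopConfig.cnLawEDist μ (bondLoopConfig δ (θ + α)) ν (bondLoopConfig δ' (θ + β)) =
      RandomPlanarGeometry.LoopConfig.cnLawEDist μ (bondLoopConfig δ α) ν (bondLoopConfig δ' β) :=
  RandomPlanarGeometry.LoopConfig.cnLawEDist_congr fun ε ω ω' ↦ isClose_bondLoopConfig_add δ δ' θ α β ε ω ω'

/-! ### Reflected configurations have reflected-and-reversed loop representations -/

/-- **Reflecting the configuration reflects the typed loop representation, up to reversing its
members.** For a lattice reflection `τ` realised on the midpoints of `δL(α)` by the linear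
isometry `S` and preserving types-after-reversal, `u` is a loop of type `i` of the reflected
configuration `τ(ω)` iff `u` read backwards is the `S`-image of a loop of type `i` of `ω`
(`isoRectLoopCurve_map_reverse`; the change of base point is absorbed because every dart is a
base point, `IsInterfaceLoop.rotate_holds`, `loopType_rotate`). (DKKMO, arXiv:2012.11672v2,
Remark 1.8 / §4.1.) [cite: arXiv201211672v2, Remark 1.8] -/
theorem mem_isoRectLoopConfig_image_iff {τ τF : Site 2 → Site 2} (hτ : IsLatticeReflection τ τF)
    {S : ℂ ≃ₗᵢ[ℝ] ℂ} {δ α : ℝ} (hS : ∀ e, isoRectMedialPoint δ α (e.map τ) = S (isoRectMedialPoint δ α e))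
    (ht : ∀ γ : List MedialVertex, loopType ((γ.map (Sym2.map τ)).reverse) = loopType γ)
    (ω : BondConfig (Site 2)) (i : Fin 2) (u : RandomPlanarGeometry.UnbasedLoop ℂ) :
    u ∈ (isoRectLoopConfig δ α (Sym2.map τ '' ω)).F i ↔
      u.reverse ∈ ((isoRectLoopConfig δ α ω).map (RandomPlanarGeometry.toCM S) S.isometry).F i := by
  rw [mem_isoRectLoopConfig_iff, RandomPlanarGeometry.LoopConfig.mem_map_iff]
  constructor
  · rintro ⟨γ', hγ', hti, rfl⟩
    set μ := (γ'.map (Sym2.map τ)).reverse with hμdef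
    have hμγ : (μ.map (Sym2.map τ)).reverse = γ' := by
      simp [hμdef, List.map_reverse, List.map_map, Function.comp_def, hτ.map_map]
    have hμ : IsInterfaceLoop ω μ := by simpa [hτ.image_image] using hτ.isInterfaceLoop hγ'
    have key := isoRectLoopCurve_map_reverse hS hμ.ne_nil
    rw [hμγ] at key
    have hrot : IsInterfaceLoop ω (μ.rotate (μ.length - 1)) := IsInterfaceLoop.rotate_holds hμ _
    refine ⟨RandomPlanarGeometry.UnbasedLoop.mk (RandomPlanarGeometry.BasedLoop.mk
      (isoRectLoopCurve δ α (μ.rotate (μ.length - 1))) (isLoop_isoRectLoopCurve δ α hrot.ne_nil)), ?_, ?_⟩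
    · refine (mem_isoRectLoopConfig_iff).2 ⟨_, hrot, ?_, rfl⟩
      rw [loopType_rotate, ← ht μ, hμγ, hti]
    · rw [RandomPlanarGeometry.UnbasedLoop.map_mk, RandomPlanarGeometry.UnbasedLoop.reverse_mk]
      congr 1
      apply RandomPlanarGeometry.BasedLoop.mk_eq_mk.2
      change (isoRectLoopCurve δ α (μ.rotate (μ.length - 1))).map (RandomPlanarGeometry.toCM S) =
        (isoRectLoopCurve δ α γ').reverse
      rw [key, RandomPlanarGeometry.CurveClass.reverse_reverse]
  · rintro ⟨_, ⟨γ, hγ, hti, rfl⟩, hu⟩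
    have hμ : IsInterfaceLoop ω (γ.rotate 1) := IsInterfaceLoop.rotate_holds hγ 1
    have key := isoRectLoopCurve_map_reverse hS hμ.ne_nil
    have hrot : (γ.rotate 1).rotate ((γ.rotate 1).length - 1) = γ := by
      rw [List.length_rotate, List.rotate_rotate,
        show 1 + (γ.length - 1) = γ.length by have := hγ.length_pos; omega, List.rotate_length]
    rw [hrot] at key
    have hγ'' : IsInterfaceLoop (Sym2.map τ '' ω) (((γ.rotate 1).map (Sym2.map τ)).reverse) :=
      hτ.isInterfaceLoop hμ
    refine ⟨_, hγ'', by rw [ht, loopType_rotate, hti], ?_⟩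
    rw [← RandomPlanarGeometry.UnbasedLoop.reverse_reverse u, hu.symm, RandomPlanarGeometry.UnbasedLoop.map_mk,
      RandomPlanarGeometry.UnbasedLoop.reverse_mk]
    congr 1
    apply RandomPlanarGeometry.BasedLoop.mk_eq_mk.2
    exact key.symm

/-- Consequence for `d_CN`: the loop representation of the reflected configuration is as close
to any configuration as the reflected loop representation is (only the unoriented distance `d`
is used, `IsClose.of_forall_mem_or_reverse_mem`). [folklore] -/
theorem isClose_isoRectLoopConfig_image_iff {τ τF : Site 2 → Site 2} (hτ : IsLatticeReflection τ τF)
    {S : ℂ ≃ₗᵢ[ℝ] ℂ} {δ α : ℝ} (hS : ∀ e, isoRectMedialPoint δ α (e.map τ) = S (isoRectMedialPoint δ α e))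
    (ht : ∀ γ : List MedialVertex, loopType ((γ.map (Sym2.map τ)).reverse) = loopType γ)
    (ω : BondConfig (Site 2)) (ε : ℝ) (c : RandomPlanarGeometry.LoopConfig ℂ) :
    RandomPlanarGeometry.LoopConfig.IsClose ε (isoRectLoopConfig δ α (Sym2.map τ '' ω)) c ↔
      RandomPlanarGeometry.LoopConfig.IsClose ε
        ((isoRectLoopConfig δ α ω).map (RandomPlanarGeometry.toCM S) S.isometry) c := by
  have h₁ : ∀ i, ∀ u ∈ (isoRectLoopConfig δ α (Sym2.map τ '' ω)).F i,
      u ∈ ((isoRectLoopConfig δ α ω).map (RandomPlanarGeometry.toCM S) S.isometry).F i ∨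
        u.reverse ∈ ((isoRectLoopConfig δ α ω).map (RandomPlanarGeometry.toCM S) S.isometry).F i :=
    fun i u hu ↦ Or.inr ((mem_isoRectLoopConfig_image_iff hτ hS ht ω i u).1 hu)
  have h₂ : ∀ i, ∀ u ∈ ((isoRectLoopConfig δ α ω).map (RandomPlanarGeometry.toCM S) S.isometry).F i,
      u ∈ (isoRectLoopConfig δ α (Sym2.map τ '' ω)).F i ∨
        u.reverse ∈ (isoRectLoopConfig δ α (Sym2.map τ '' ω)).F i :=
    fun i u hu ↦ Or.inr ((mem_isoRectLoopConfig_image_iff hτ hS ht ω i u.reverse).2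
      (by rwa [RandomPlanarGeometry.UnbasedLoop.reverse_reverse]))
  exact ⟨fun h ↦ h.of_forall_mem_or_reverse_mem h₂ h₁, fun h ↦ h.of_forall_mem_or_reverse_mem h₁ h₂⟩

/-! ### Remark 1.8 for the printed coupling distance -/

/-- `BondConfig (Site 2) = Set (Sym2 ℤ²)` (a countable product of two-point spaces) is a
standard Borel space; needed to disintegrate couplings (`cnLawEDist_triangle`). [folklore] -/
theorem standardBorelSpace_bondConfig : StandardBorelSpace (BondConfig (Site 2)) := by
  unfold BondConfig Set
  exact StandardBorelSpace.pi_countable (α := fun _ ↦ Prop)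

/-- **Remark 1.8 at the level of the printed coupling distance.** For every angle `θ` and mesh
`δ` (DKKMO use `θ ∈ (0, π)`; the two exact symmetries hold for all `θ`), with `φ = φ_{δL(π/2)}` read through its loop representation `X = isoRectLoopConfig δ (π/2)` and
`R_θ` the rotation by `θ`,
`d_CN((φ, X), (φ, R_θ ∘ X)) ≤ 2 · d_CN((φ_{δL(θ)}, X_θ), (φ, X))`.
Proof (DKKMO, arXiv:2012.11672v2, Remark 1.8; v1 §7.1): `R_θ = S_{θ/2} ∘ S_0`
(`lineReflection_lineReflection_zero`); `S_0 ∘ X` is, up to reversing members, `X ∘ swap` with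
`swap` a measure-preserving involution of `φ` (`isoRectPercolation_map_swapSite`,
`isClose_isoRectLoopConfig_image_iff`), so `d_CN(X, R_θ X) ≤ d_CN(X, S_{θ/2} X)` (transport,
`cnLawEDist_map_le`); then `d_CN(X, S_{θ/2} X) ≤ d_CN(X, X_θ) + d_CN(X_θ, S_{θ/2} X)` (gluing,
`cnLawEDist_triangle`) and `d_CN(X_θ, S_{θ/2} X) = d_CN(S_{θ/2} X_θ, S_{θ/2} X) = d_CN(X_θ, X)`
because `S_{θ/2}` is an exact symmetry of `φ_{δL(θ)}` (`isoRectPercolation_map_reflSite`) and an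
isometry fixing `0` (`isClose_map_iff`). [cite: arXiv201211672v2, Remark 1.8] -/
theorem cnLawEDist_rotate_le (θ δ : ℝ) :
    RandomPlanarGeometry.LoopConfig.cnLawEDist (isoRectPercolation (π / 2)) (isoRectLoopConfig δ (π / 2))
        (isoRectPercolation (π / 2)) (fun ω ↦ (isoRectLoopConfig δ (π / 2) ω).map
          (RandomPlanarGeometry.toCM (rotation (Circle.exp θ))) (rotation (Circle.exp θ)).isometry) ≤
      2 * RandomPlanarGeometry.LoopConfig.cnLawEDist (isoRectPercolation θ) (isoRectLoopConfig δ θ)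
        (isoRectPercolation (π / 2)) (isoRectLoopConfig δ (π / 2)) := by
  haveI := standardBorelSpace_bondConfig
  -- notation
  set μ := isoRectPercolation (π / 2) with hμ
  set X : BondConfig (Site 2) → RandomPlanarGeometry.LoopConfig ℂ := isoRectLoopConfig δ (π / 2) with hX
  set μθ := isoRectPercolation θ with hμθ
  set Xθ : BondConfig (Site 2) → RandomPlanarGeometry.LoopConfig ℂ := isoRectLoopConfig δ θ with hXθ
  set S : ℂ ≃ₗᵢ[ℝ] ℂ := RandomPlanarGeometry.lineReflection (θ / 2) with hSdef
  set S₀ : ℂ ≃ₗᵢ[ℝ] ℂ := RandomPlanarGeometry.lineReflection 0 with hS₀def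
  set R : ℂ ≃ₗᵢ[ℝ] ℂ := rotation (Circle.exp θ) with hRdef
  have hS : Isometry (RandomPlanarGeometry.toCM S) := S.isometry
  have hS₀ : Isometry (RandomPlanarGeometry.toCM S₀) := S₀.isometry
  have hR : Isometry (RandomPlanarGeometry.toCM R) := R.isometry
  have hS0 : RandomPlanarGeometry.toCM S 0 = 0 := map_zero S
  -- the reflected random configurations
  set SX : BondConfig (Site 2) → RandomPlanarGeometry.LoopConfig ℂ :=
    fun ω ↦ (X ω).map (RandomPlanarGeometry.toCM S) hS with hSX
  set g : BondConfig (Site 2) → BondConfig (Site 2) := fun ω ↦ swapPerm '' ω with hg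
  set ρ : BondConfig (Site 2) → BondConfig (Site 2) := fun ω ↦ reflPerm '' ω with hρ
  have hgm : Measurable g := measurable_image_equiv swapPerm
  have hρm : Measurable ρ := measurable_image_equiv reflPerm
  have hgg : ∀ ω, g (g ω) = ω := fun ω ↦ by
    simp only [hg, coe_swapPerm]; exact isLatticeReflection_swapSite.image_image ω
  have hμg : μ.map g = μ := isoRectPercolation_map_swapSite
  have hμρ : μθ.map ρ = μθ := isoRectPercolation_map_reflSite θ
  -- generation data (for measurability of the exceptional events)
  have gX := gen_isoRectLoopConfig δ (π / 2)
  have gXθ := gen_isoRectLoopConfig δ θ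
  have gSX := RandomPlanarGeometry.LoopConfig.gen_map gX (RandomPlanarGeometry.toCM S) hS
  have hmS := fun i (k : {γ : List MedialVertex // γ ≠ []}) ↦ measurableSet_setOf_isInterfaceLoop_and k.1 i
  -- Step A: `R_θ ∘ X` versus `S ∘ X ∘ g` (pointwise, up to reversal), then transport along `g`.
  have hA : RandomPlanarGeometry.LoopConfig.cnLawEDist μ X μ
      (fun ω ↦ (X ω).map (RandomPlanarGeometry.toCM R) hR) ≤
      RandomPlanarGeometry.LoopConfig.cnLawEDist μ X μ SX := by
    have hcomp : (RandomPlanarGeometry.toCM S).comp (RandomPlanarGeometry.toCM S₀) = RandomPlanarGeometry.toCM R := by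
      ext1 z
      change S (S₀ z) = R z
      rw [hSdef, hS₀def, hRdef, RandomPlanarGeometry.lineReflection_lineReflection_zero, mul_div_cancel₀ θ two_ne_zero]
    have hpt : ∀ ε ω ω', RandomPlanarGeometry.LoopConfig.IsClose ε (X ω) ((X ω').map (RandomPlanarGeometry.toCM R) hR) ↔
        RandomPlanarGeometry.LoopConfig.IsClose ε (X ω) (SX (g ω')) := by
      intro ε ω ω'
      rw [← RandomPlanarGeometry.LoopConfig.map_congr hcomp (hS.comp hS₀) hR,
        ← RandomPlanarGeometry.LoopConfig.map_map hS₀ hS, RandomPlanarGeometry.LoopConfig.isClose_comm,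
        ← RandomPlanarGeometry.LoopConfig.isClose_map_reverse_congr hS
          (mem_isoRectLoopConfig_image_iff isLatticeReflection_swapSite (S := S₀)
            (isoRectMedialPoint_map_swapSite δ) loopType_map_swapSite_reverse ω'),
        RandomPlanarGeometry.LoopConfig.isClose_comm]
      simp only [hSX, hg, hX, coe_swapPerm]
    rw [RandomPlanarGeometry.LoopConfig.cnLawEDist_congr hpt]
    have hm : ∀ ε, MeasurableSet {p : BondConfig (Site 2) × BondConfig (Site 2) |
        RandomPlanarGeometry.LoopConfig.IsClose ε (X p.1) ((SX ∘ g) p.2)} := fun ε ↦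
      RandomPlanarGeometry.LoopConfig.measurableSet_isClose_of_gen hmS gX
        (fun i k ↦ hgm (hmS i k)) (RandomPlanarGeometry.LoopConfig.gen_comp gSX g) ε
    have key := RandomPlanarGeometry.LoopConfig.cnLawEDist_map_le measurable_id hgm μ μ X (SX ∘ g) hm
    rw [Measure.map_id, hμg] at key
    refine key.trans (le_of_eq (RandomPlanarGeometry.LoopConfig.cnLawEDist_congr fun ε ω ω' ↦ ?_))
    simp only [Function.comp_apply, id_eq, hgg]
  -- Step B: triangle inequality through `(μθ, Xθ)`.
  have hB : RandomPlanarGeometry.LoopConfig.cnLawEDist μ X μ SX ≤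
      RandomPlanarGeometry.LoopConfig.cnLawEDist μ X μθ Xθ + RandomPlanarGeometry.LoopConfig.cnLawEDist μθ Xθ μ SX :=
    RandomPlanarGeometry.LoopConfig.cnLawEDist_triangle μ μθ μ X Xθ SX fun ε ↦
      RandomPlanarGeometry.LoopConfig.measurableSet_isClose_of_gen hmS gX hmS gSX ε
  -- Step C: the exact symmetry of `φ_{δL(θ)}`: `d_CN(Xθ, S X) = d_CN(Xθ, X)`.
  have hC : RandomPlanarGeometry.LoopConfig.cnLawEDist μθ Xθ μ SX ≤
      RandomPlanarGeometry.LoopConfig.cnLawEDist μθ Xθ μ X := by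
    have hm : ∀ ε, MeasurableSet {p : BondConfig (Site 2) × BondConfig (Site 2) |
        RandomPlanarGeometry.LoopConfig.IsClose ε (Xθ p.1) (SX p.2)} := fun ε ↦
      RandomPlanarGeometry.LoopConfig.measurableSet_isClose_of_gen hmS gXθ hmS gSX ε
    have key := RandomPlanarGeometry.LoopConfig.cnLawEDist_map_le hρm measurable_id μθ μ Xθ SX hm
    rw [Measure.map_id, hμρ] at key
    refine key.trans (le_of_eq (RandomPlanarGeometry.LoopConfig.cnLawEDist_congr fun ε ω ω' ↦ ?_))
    simp only [Function.comp_apply, id_eq, hρ, coe_reflPerm, hSX]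
    rw [isClose_isoRectLoopConfig_image_iff isLatticeReflection_reflSite (isoRectMedialPoint_map_reflSite δ θ)
      loopType_map_reflSite_reverse, RandomPlanarGeometry.LoopConfig.isClose_map_iff hS hS0]
  -- assemble
  calc RandomPlanarGeometry.LoopConfig.cnLawEDist μ X μ (fun ω ↦ (X ω).map (RandomPlanarGeometry.toCM R) hR)
      ≤ RandomPlanarGeometry.LoopConfig.cnLawEDist μ X μθ Xθ + RandomPlanarGeometry.LoopConfig.cnLawEDist μθ Xθ μ SX :=
        hA.trans hB
    _ ≤ RandomPlanarGeometry.LoopConfig.cnLawEDist μθ Xθ μ X + RandomPlanarGeometry.LoopConfig.cnLawEDist μθ Xθ μ X := by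
        rw [RandomPlanarGeometry.LoopConfig.cnLawEDist_comm μ X μθ Xθ]
        exact add_le_add le_rfl hC
    _ = 2 * RandomPlanarGeometry.LoopConfig.cnLawEDist μθ Xθ μ X := (two_mul _).symm

/-! ### Assembly: Theorem 1.7 implies Theorem 1.2 (printed forms) -/

/-- The angular distance function `g(θ) = d_CN((φ, Y_0), (φ, Y_θ))` of the square lattice
(`Y_θ = bondLoopConfig δ θ`, `φ` critical bond percolation) is sub-additive: triangle inequality
for the coupling distance and rotation invariance. [folklore] -/
theorem cnLawEDist_bondLoopConfig_subadditive (δ α β : ℝ) :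
    RandomPlanarGeometry.LoopConfig.cnLawEDist (bondPercolation (zdGraph 2) half) (bondLoopConfig δ 0)
        (bondPercolation (zdGraph 2) half) (bondLoopConfig δ (α + β)) ≤
      RandomPlanarGeometry.LoopConfig.cnLawEDist (bondPercolation (zdGraph 2) half) (bondLoopConfig δ 0)
          (bondPercolation (zdGraph 2) half) (bondLoopConfig δ α) +
        RandomPlanarGeometry.LoopConfig.cnLawEDist (bondPercolation (zdGraph 2) half) (bondLoopConfig δ 0)
          (bondPercolation (zdGraph 2) half) (bondLoopConfig δ β) := by
  haveI := standardBorelSpace_bondConfig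
  refine (RandomPlanarGeometry.LoopConfig.cnLawEDist_triangle _ (bondPercolation (zdGraph 2) half) _ _
    (bondLoopConfig δ α) _ (measurableSet_isClose_bondLoopConfig δ 0 δ (α + β))).trans ?_
  refine add_le_add le_rfl (le_of_eq ?_)
  rw [← cnLawEDist_bondLoopConfig_add _ _ δ δ α 0 β, add_zero]

/-- **DKKMO's Theorem 1.2 (printed `d_CN` form, `q = 1`) follows from their Theorem 1.7
(printed form)** by the reflection argument of Remark 1.8, with constants uniform in the angle:
`d_CN(φ_{δℤ²}, φ_{e^{iα}δℤ²}) ≤ 4C (δ/√2)^c ≤ 4C δ^c` for every `α` and `δ > 0`. Steps: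
`φ_{δ'L(π/2)}` is `φ` on `√2 δ' e^{iπ/4} ℤ²` (`isoRectLoopConfig_pi_div_two`,
`isoRectPercolation_pi_div_two`); Remark 1.8 (`cnLawEDist_rotate_le`) and rotation invariance
(`cnLawEDist_bondLoopConfig_add`) give `g(θ) ≤ 2Cδ'^c` for `θ ∈ (0, π)`; `g(0) = 0`,
`2π`-periodicity and sub-additivity (`cnLawEDist_bondLoopConfig_subadditive`, the triangle
inequality for the coupling distance, `cnLawEDist_triangle`) give all angles.
(Duminil-Copin–Kozlowski–Krachun–Manolescu–Oulamara, arXiv:2012.11672v2 (2026), Remark 1.8 and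
§4.1.) [cite: arXiv201211672v2, Remark 1.8] -/
theorem dkkmo_theorem_1_2_of_theorem_1_7 (h17 : dkkmo_theorem_1_7) : dkkmo_theorem_1_2 := by
  obtain ⟨c, C, hc, hC, H⟩ := h17
  refine ⟨c, 4 * C, hc, by positivity, fun α _ δ' hδ' ↦ ?_⟩
  -- Step 0: the mesh `δ = δ'/√2` of the isoradial picture.
  have hs2 : 0 < Real.sqrt 2 := Real.sqrt_pos.2 (by norm_num)
  have hs2' : (1 : ℝ) ≤ Real.sqrt 2 := Real.one_le_sqrt.2 (by norm_num)
  set δ := δ' / Real.sqrt 2 with hδdef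
  have hδpos : 0 < δ := div_pos hδ' hs2
  have hδle : δ ≤ δ' := div_le_self hδ'.le hs2'
  have hδ'eq : Real.sqrt 2 * δ = δ' := by rw [hδdef]; field_simp
  set ε := ENNReal.ofReal (C * δ ^ c) with hεdef
  set ν := bondPercolation (zdGraph 2) half with hν
  set f : ℝ → ℝ≥0∞ := fun θ ↦ RandomPlanarGeometry.LoopConfig.cnLawEDist ν (bondLoopConfig δ' 0) ν (bondLoopConfig δ' θ)
    with hfdef
  change f α ≤ ENNReal.ofReal (4 * C * δ' ^ c)
  -- Step 1: for `θ ∈ (0, π)`, `f θ ≤ 2ε` (Remark 1.8 transported to `ℤ²`).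
  have step1 : ∀ θ ∈ Set.Ioo (0 : ℝ) π, f θ ≤ 2 * ε := by
    intro θ hθ
    have key := cnLawEDist_rotate_le θ δ
    have hT : RandomPlanarGeometry.LoopConfig.cnLawEDist (isoRectPercolation θ) (isoRectLoopConfig δ θ)
        (isoRectPercolation (π / 2)) (isoRectLoopConfig δ (π / 2)) ≤ ε := (H θ hθ δ hδpos).le
    have hXY : isoRectLoopConfig δ (π / 2) = bondLoopConfig δ' (π / 4) := by
      funext ω; rw [isoRectLoopConfig_pi_div_two, hδ'eq]
    have hident : RandomPlanarGeometry.LoopConfig.cnLawEDist (isoRectPercolation (π / 2)) (isoRectLoopConfig δ (π / 2))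
        (isoRectPercolation (π / 2)) (fun ω ↦ (isoRectLoopConfig δ (π / 2) ω).map
          (RandomPlanarGeometry.toCM (rotation (Circle.exp θ))) (rotation (Circle.exp θ)).isometry) = f θ := by
      have hfun : (fun ω ↦ (isoRectLoopConfig δ (π / 2) ω).map
          (RandomPlanarGeometry.toCM (rotation (Circle.exp θ))) (rotation (Circle.exp θ)).isometry) =
          bondLoopConfig δ' (π / 4 + θ) := by
        funext ω
        rw [hXY, add_comm, bondLoopConfig_add]
      rw [hfun, isoRectPercolation_pi_div_two, hXY]
      show RandomPlanarGeometry.LoopConfig.cnLawEDist ν (bondLoopConfig δ' (π / 4)) ν (bondLoopConfig δ' (π / 4 + θ)) =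
        RandomPlanarGeometry.LoopConfig.cnLawEDist ν (bondLoopConfig δ' 0) ν (bondLoopConfig δ' θ)
      rw [← cnLawEDist_bondLoopConfig_add ν ν δ' δ' (π / 4) 0 θ, add_zero]
    rw [← hident]
    refine key.trans ?_
    gcongr
  -- Step 2: all angles, by periodicity and sub-additivity: `f ≤ 4ε`.
  have step2 : f α ≤ 4 * ε := by
    have hper : ∀ θ (n : ℤ), f (θ + n * (2 * π)) = f θ := fun θ n ↦ by
      simp only [hfdef, bondLoopConfig_periodic]
    have hsub : ∀ θ₁ θ₂, f (θ₁ + θ₂) ≤ f θ₁ + f θ₂ := fun θ₁ θ₂ ↦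
      cnLawEDist_bondLoopConfig_subadditive δ' θ₁ θ₂
    have h0 : f 0 = 0 := by
      simp only [hfdef]
      exact RandomPlanarGeometry.LoopConfig.cnLawEDist_self _ _ (measurableSet_isClose_bondLoopConfig δ' 0 δ' 0)
    have h2ε : 2 * ε ≤ 4 * ε := by gcongr; norm_num
    have hmem : toIcoMod Real.two_pi_pos 0 α ∈ Set.Ico 0 (0 + 2 * π) :=
      toIcoMod_mem_Ico Real.two_pi_pos 0 α
    have hαeq : f α = f (toIcoMod Real.two_pi_pos 0 α) := by
      conv_lhs => rw [← toIcoMod_add_toIcoDiv_zsmul Real.two_pi_pos 0 α, zsmul_eq_mul]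
      exact hper _ _
    rw [hαeq]
    rcases hmem.1.eq_or_lt with h | h
    · rw [← h, h0]; exact bot_le
    · by_cases hπ : toIcoMod Real.two_pi_pos 0 α < π
      · exact (step1 _ ⟨h, hπ⟩).trans h2ε
      · have hhalf : toIcoMod Real.two_pi_pos 0 α / 2 ∈ Set.Ioo (0 : ℝ) π := by
          constructor
          · linarith
          · have := hmem.2; linarith
        calc f (toIcoMod Real.two_pi_pos 0 α)
            = f (toIcoMod Real.two_pi_pos 0 α / 2 + toIcoMod Real.two_pi_pos 0 α / 2) := by
              rw [add_halves]
          _ ≤ f (toIcoMod Real.two_pi_pos 0 α / 2) + f (toIcoMod Real.two_pi_pos 0 α / 2) :=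
              hsub _ _
          _ ≤ 2 * ε + 2 * ε := add_le_add (step1 _ hhalf) (step1 _ hhalf)
          _ = 4 * ε := by rw [← add_mul]; norm_num
  -- Step 3: constants.
  have h4 : (4 : ℝ≥0∞) * ε = ENNReal.ofReal (4 * (C * δ ^ c)) := by
    rw [hεdef, ENNReal.ofReal_mul (by norm_num : (0 : ℝ) ≤ 4), ENNReal.ofReal_ofNat]
  refine step2.trans ?_
  rw [h4]
  refine ENNReal.ofReal_le_ofReal ?_
  rw [mul_assoc]
  refine mul_le_mul_of_nonneg_left ?_ (by norm_num)
  exact mul_le_mul_of_nonneg_left (Real.rpow_le_rpow hδpos.le hδle hc.le) hC.le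

end Literature.Probability.Percolation

end
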